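import Summits.CriticalPhenomena.PercolationContinuityZ3.Theorems.PercNearOneGluingNoHeavyQuantTwinMove
import HarnessLib

/-!
# QUANT lane R8, T-DEC, leg (III): the TWIN MOVE conjecture is FALSE — an explicit exact witness and `¬ LawDec.TwinMoveDEC`

builds on p205010 (kernel theorem, internal audit signed; external expert review pending)

Support file (`--supports stmt-CriticalPhenomena-4575`), QUANT lane seat prim-quant-arm-3 (gen 62; V278 second-seat literal test of arm-1 g39's
`@[conjecture] LawDec.TwinMoveDEC`, `…QuantTwinMove`, p334361).  Theorems only, standard axioms, no sorries, no definitions, no notation.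

THE STATEMENT UNDER TEST (arm-1 g39): `R ≥ 0` a probability law on `{0..N}` whose atoms below `a` have twins (`g·R k ≤ (1−g)·R (k+a)`, `k < a`),
`0 < y < 1`, `0 ≤ z < 1`, `g ≤ 1`, `y ≤ (1−z)g`, `1 ≤ a ≤ N`, `y·N ≤ (1−z)·mean R`.  CLAIM: if `Λ = z·{0,a;g} + (1−z)R` is DEC at `(y, zag + (1−z)mean R, j)`
then `P = zδ₀ + (1−z)R` is DEC at `(y, (1−z)mean R, j)` (top `N`).

THE WITNESS (`twinMove_witness_hyp`, `twinMove_witness_not`, `not_twinMoveDEC`): `R = {1: 1/2, 3: 1/4, 12: 1/4}`, `N = 12`, `a = 2`, `g = 1/3`, `z = 1/10`,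
`j = 3`, `y = 3/10` — the threshold `y = (1−z)g` is tight, top-affordability slack (`18/5 ≤ 153/40`), the twin of the low `1` is tight (`1/6 = 1/6`), and the
instance lies in the regime `t = 153/40 ≤ 2a` ("(R2)"; it is the cell 'blob unit + free atom' `R = (3/4)·[(2/3)δ₁ + (1/3)δ₃] + (1/4)·δ₁₂`).
HYPOTHESIS: `Λ = {0: 1/15, 1: 9/20, 2: 1/30, 3: 9/40, 12: 9/40}` is DEC at `(3/10, 467/120, 3)`: flow `0 → 12: 1/15`, `1 → 12: 9/20` (giant usage `3/7`, load
`31/140 ≤ 9/40`).  CONCLUSION FAILS: `P = {0: 1/10, 1: 9/20, 3: 9/40, 12: 9/40}` at `(3/10, 153/40, 3)`: lows `{0, 1}` carry `11/20`; the mid `3` takes the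
low `1` only, at the LIGHT-branch rate `u(1,3) = 73/7` (`ρ = 73/80 ≥ y² + (1−y)ρ`), the giant `12` at `3/7`, the atoms `4..11` are empty:
`f(1,3) ≤ 63/2920`, `f(0,12) + f(1,12) ≤ 21/40`, total `< 11/20`.  MECHANISM: in `Λ` the blob mass `zg = 1/30` sits at `a = 2`, a mid that needs no shipping
(`2a ≥` target); in `P` it sits at `0` and must be shipped; the twin `3` of the low `1` is nearly useless as an absorber because `t` is close to `1 + 3`.
The SLICE sub-case `R = slice ν̂ a g` (typer's (M) for general `a`) is NOT refuted by this witness (the free atom `12` has no `(1−g)/g` partner).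

* `twinMove_witness_hyp` — `Λ` is DEC;  `twinMove_witness_not` — `P` is not DEC;  **`not_twinMoveDEC : ¬ TwinMoveDEC`**.

Evidence: memo `run/shared/lean/prim/quant/prim-quant-arm-3-g62/TWINMOVE-CEX-G62.md` (exact engine: found through lead g30's (R2-FREE) run, kit j170702
1 / 384 000 at `z = 0`; 161 exact witnesses on a small rational grid; the slice sub-case 0 / 223 479 in the same neighbourhood).

[this work]; the statement under test: prim-quant-arm-1 g39 (this lane).  Nothing here is cited as a published result.  The gluing rows served
[cite: KozmaNitzan2024, Conjecture 3 (p. 15)]; product measure [cite: Grimmett1999, §1.3 p. 10].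
-/

noncomputable section

namespace Summit.CriticalPhenomena.PercolationContinuityZ3.Theorems

namespace Quant

open Finset

namespace LawDec

/-- usage of a low atom at a GIANT absorber `h ≥ j′+1` is `x/(1−x)`. -/
private theorem usage_of_giant' (x T : ℝ) (j' l h : ℕ) (hjh : j' + 1 ≤ h) : usage x T j' l h = x / (1 - x) := by
  simp only [usage, gateOf, if_pos hjh]

/-- usage of a low atom at a MID absorber `h ≤ j′` when the credit gate is the LIGHT branch `ρ ≥ x² + (1−x)ρ`. -/
private theorem usage_of_mid_light (x T ρ : ℝ) (j' l h : ℕ) (hjh : ¬ j' + 1 ≤ h) (hρ : (T - 2 * (l : ℝ)) / ((h : ℝ) - l) = ρ)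
    (hle : x ^ 2 + (1 - x) * ρ ≤ ρ) :
    usage x T j' l h = ρ / (1 - ρ) := by
  simp only [usage, gateOf, if_neg hjh, pairGate, hρ, max_eq_left hle]

/-- **HYPOTHESIS of the witness holds**: `Λ = {0: 1/15, 1: 9/20, 2: 1/30, 3: 9/40, 12: 9/40}` is DEC at `(3/10, 467/120, 3)`, top `12`
(flow `0 → 12: 1/15`, `1 → 12: 9/20`). [this work] -/
theorem twinMove_witness_hyp : DECAtT (3 / 10) (467 / 120) 3 12 (fun h : ℕ => (if h = 0 then (1 : ℝ) / 15 else if h = 1 then 9 / 20 else if h = 2 then 1 / 30 else if h = 3 then 9 / 40 else if h = 12 then 9 / 40 else 0)) := by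
  have l_top : ∀ h, 12 < h → (fun h : ℕ => (if h = 0 then (1 : ℝ) / 15 else if h = 1 then 9 / 20 else if h = 2 then 1 / 30 else if h = 3 then 9 / 40 else if h = 12 then 9 / 40 else 0)) h = 0 := by
    intro h hh; dsimp only
    rw [if_neg (by omega), if_neg (by omega), if_neg (by omega), if_neg (by omega), if_neg (by omega)]
  have l_mass : ∑ h ∈ Finset.range (12 + 1), (fun h : ℕ => (if h = 0 then (1 : ℝ) / 15 else if h = 1 then 9 / 20 else if h = 2 then 1 / 30 else if h = 3 then 9 / 40 else if h = 12 then 9 / 40 else 0)) h = 1 := by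
    simp only [Finset.sum_range_succ, Finset.sum_range_zero]; norm_num
  rw [decAtT_iff_flowAtT _ _ 3 12 _ (by norm_num) (by norm_num) l_top l_mass]
  have ug : ∀ l h, 3 + 1 ≤ h → usage (3 / 10 : ℝ) (467 / 120) 3 l h = 3 / 7 := by
    intro l h hh; rw [usage_of_giant' (3 / 10) (467 / 120) 3 l h hh]; norm_num
  refine ⟨fun l h => if h = 12 then (if l = 0 then 1 / 15 else if l = 1 then 9 / 20 else 0) else 0, ?_, ?_, ?_, ?_⟩
  · intro l h
    dsimp only
    split_ifs <;> norm_num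
  · intro l h hlh
    dsimp only at hlh
    split_ifs at hlh with h1 h2 h3
    · subst h1; subst h2; norm_num
    · subst h1; subst h3; norm_num
    · exact absurd hlh (lt_irrefl 0)
    · exact absurd hlh (lt_irrefl 0)
  · intro l hl hlow
    interval_cases l
    · simp only [Finset.sum_range_succ, Finset.sum_range_zero]; norm_num
    · simp only [Finset.sum_range_succ, Finset.sum_range_zero]; norm_num
    · exfalso; norm_num at hlow
    · exfalso; norm_num at hlow
  · intro h hh habs
    interval_cases h <;> simp only [Finset.sum_range_succ, Finset.sum_range_zero] <;> norm_num [ug]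

/-- **CONCLUSION of the witness fails**: `P = {0: 1/10, 1: 9/20, 3: 9/40, 12: 9/40}` is NOT DEC at `(3/10, 153/40, 3)`, top `12`
(dual combination: `u(1,3) = 73/7`, giants `3/7`, the other cells forced to `0`). [this work] -/
theorem twinMove_witness_not : ¬ DECAtT (3 / 10) (153 / 40) 3 12 (fun h : ℕ => (if h = 0 then (1 : ℝ) / 10 else if h = 1 then 9 / 20 else if h = 3 then 9 / 40 else if h = 12 then 9 / 40 else 0)) := by
  have p_top : ∀ h, 12 < h → (fun h : ℕ => (if h = 0 then (1 : ℝ) / 10 else if h = 1 then 9 / 20 else if h = 3 then 9 / 40 else if h = 12 then 9 / 40 else 0)) h = 0 := by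
    intro h hh; dsimp only
    rw [if_neg (by omega), if_neg (by omega), if_neg (by omega), if_neg (by omega)]
  have p_mass : ∑ h ∈ Finset.range (12 + 1), (fun h : ℕ => (if h = 0 then (1 : ℝ) / 10 else if h = 1 then 9 / 20 else if h = 3 then 9 / 40 else if h = 12 then 9 / 40 else 0)) h = 1 := by
    simp only [Finset.sum_range_succ, Finset.sum_range_zero]; norm_num
  rw [decAtT_iff_flowAtT _ _ 3 12 _ (by norm_num) (by norm_num) p_top p_mass]
  rintro ⟨f, hf0, hsupp, hlow, hcap⟩
  have ug : ∀ l h, 3 + 1 ≤ h → usage (3 / 10 : ℝ) (153 / 40) 3 l h = 3 / 7 := by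
    intro l h hh; rw [usage_of_giant' (3 / 10) (153 / 40) 3 l h hh]; norm_num
  have u13 : usage (3 / 10 : ℝ) (153 / 40) 3 1 3 = 73 / 7 := by
    rw [usage_of_mid_light (3 / 10) (153 / 40) (73 / 80) 3 1 3 (by norm_num) (by norm_num) (by norm_num)]; norm_num
  -- zero pattern: rows 2, 3 are not lows; the cells (0, h ≤ 3) and (1, h ≤ 2) are incompatible
  have hz : ∀ l h : ℕ, ¬ (l ≤ 3 ∧ 2 * (l : ℝ) < 153 / 40 ∧ h ≤ 12 ∧ (3 + 1 ≤ h ∨ (153 / 40 : ℝ) < (l : ℝ) + h)) → f l h = 0 := by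
    intro l h hn
    by_contra hne
    exact hn (hsupp l h (lt_of_le_of_ne (hf0 l h) (Ne.symm hne)))
  have r2 : ∀ h, f 2 h = 0 := fun h => hz 2 h (by norm_num)
  have r3 : ∀ h, f 3 h = 0 := fun h => hz 3 h (by norm_num)
  have z00 : f 0 0 = 0 := hz 0 0 (by norm_num)
  have z01 : f 0 1 = 0 := hz 0 1 (by norm_num)
  have z02 : f 0 2 = 0 := hz 0 2 (by norm_num)
  have z03 : f 0 3 = 0 := hz 0 3 (by norm_num)
  have z10 : f 1 0 = 0 := hz 1 0 (by norm_num)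
  have z11 : f 1 1 = 0 := hz 1 1 (by norm_num)
  have z12 : f 1 2 = 0 := hz 1 2 (by norm_num)
  -- the empty giants 4..11 absorb nothing
  have col : ∀ h, 3 + 1 ≤ h → h ≤ 11 → f 0 h = 0 ∧ f 1 h = 0 := by
    intro h h4 h11
    have c := hcap h (by omega) (Or.inl h4)
    have hP : (fun h : ℕ => (if h = 0 then (1 : ℝ) / 10 else if h = 1 then 9 / 20 else if h = 3 then 9 / 40 else if h = 12 then 9 / 40 else 0)) h = 0 := by
      dsimp only; rw [if_neg (by omega), if_neg (by omega), if_neg (by omega), if_neg (by omega)]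
    rw [hP] at c
    simp only [Finset.sum_range_succ, Finset.sum_range_zero, zero_add] at c
    rw [ug 0 h h4, ug 1 h h4, ug 2 h h4, ug 3 h h4, r2 h, r3 h] at c
    constructor <;> nlinarith [hf0 0 h, hf0 1 h]
  obtain ⟨a4, b4⟩ := col 4 (by norm_num) (by norm_num)
  obtain ⟨a5, b5⟩ := col 5 (by norm_num) (by norm_num)
  obtain ⟨a6, b6⟩ := col 6 (by norm_num) (by norm_num)
  obtain ⟨a7, b7⟩ := col 7 (by norm_num) (by norm_num)
  obtain ⟨a8, b8⟩ := col 8 (by norm_num) (by norm_num)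
  obtain ⟨a9, b9⟩ := col 9 (by norm_num) (by norm_num)
  obtain ⟨a10, b10⟩ := col 10 (by norm_num) (by norm_num)
  obtain ⟨a11, b11⟩ := col 11 (by norm_num) (by norm_num)
  -- low equations for 0 and 1, capacities of the mid 3 and the giant 12
  have e0 := hlow 0 (by norm_num) (by norm_num)
  have e1 := hlow 1 (by norm_num) (by norm_num)
  have c3 := hcap 3 (by norm_num) (Or.inr (by norm_num))
  have c12 := hcap 12 (by norm_num) (Or.inl (by norm_num))
  simp only [Finset.sum_range_succ, Finset.sum_range_zero, zero_add] at e0 e1 c3 c12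
  norm_num at e0 e1 c3 c12
  rw [z00, z01, z02, z03, a4, a5, a6, a7, a8, a9, a10, a11] at e0
  rw [z10, z11, z12, b4, b5, b6, b7, b8, b9, b10, b11] at e1
  rw [z03, r2 3, r3 3, u13] at c3
  rw [r2 12, r3 12, ug 0 12 (by norm_num), ug 1 12 (by norm_num)] at c12
  norm_num at e0 e1 c3 c12
  nlinarith [hf0 0 12, hf0 1 3, hf0 1 12]

/-- **`LawDec.TwinMoveDEC` IS FALSE (arm-3 g62).**  The instance `y = 3/10`, `z = 1/10`, `g = 1/3`, `a = 2`, `j = 3`, `N = 12`,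
`R = {1: 1/2, 3: 1/4, 12: 1/4}` satisfies every hypothesis of the conjecture (twins: `g·R 1 = 1/6 = (1−g)·R 3`; threshold `y = (1−z)g`;
`y·N = 18/5 ≤ (1−z)·mean R = 153/40`; `Λ` DEC by `twinMove_witness_hyp`) and violates its conclusion (`twinMove_witness_not`).
builds on p205010 (kernel theorem, internal audit signed; external expert review pending). [this work] -/
theorem not_twinMoveDEC : ¬ TwinMoveDEC := by
  intro H
  have hmean : ∑ h ∈ Finset.range (12 + 1), (h : ℝ) * (fun h : ℕ => (if h = 1 then (1 : ℝ) / 2 else if h = 3 then 1 / 4 else if h = 12 then 1 / 4 else 0)) h = 17 / 4 := by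
    simp only [Finset.sum_range_succ, Finset.sum_range_zero]; norm_num
  have hmass : ∑ h ∈ Finset.range (12 + 1), (fun h : ℕ => (if h = 1 then (1 : ℝ) / 2 else if h = 3 then 1 / 4 else if h = 12 then 1 / 4 else 0)) h = 1 := by
    simp only [Finset.sum_range_succ, Finset.sum_range_zero]; norm_num
  have hL : DECAtT (3 / 10) ((1 / 10 : ℝ) * ((2 : ℕ) : ℝ) * (1 / 3) + (1 - 1 / 10) * ∑ h ∈ Finset.range (12 + 1), (h : ℝ) * (fun h : ℕ => (if h = 1 then (1 : ℝ) / 2 else if h = 3 then 1 / 4 else if h = 12 then 1 / 4 else 0)) h) 3 12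
      (fun h : ℕ => (1 / 10 : ℝ) * ((1 / 3 : ℝ) * (if (h : ℕ) = ((2 : ℕ) : ℕ) then (1 : ℝ) else 0) + (1 - (1 / 3 : ℝ)) * (if (h : ℕ) = ((0 : ℕ) : ℕ) then (1 : ℝ) else 0))
        + (1 - 1 / 10) * (fun h : ℕ => (if h = 1 then (1 : ℝ) / 2 else if h = 3 then 1 / 4 else if h = 12 then 1 / 4 else 0)) h) := by
    convert twinMove_witness_hyp using 2
    · rw [hmean]; norm_num
    · rename_i k
      rcases k with _ | _ | _ | _ | _ | _ | _ | _ | _ | _ | _ | _ | _ | k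
      all_goals norm_num
      all_goals (try simp)
  have h := H (3 / 10) (1 / 10) (1 / 3) 2 3 12 (fun h : ℕ => (if h = 1 then (1 : ℝ) / 2 else if h = 3 then 1 / 4 else if h = 12 then 1 / 4 else 0)) (by norm_num) (by norm_num) (by norm_num) (by norm_num) (by norm_num) (by norm_num)
    (by norm_num) (by norm_num) (fun h => by split_ifs <;> norm_num)
    (fun h hh => by rw [if_neg (by omega), if_neg (by omega), if_neg (by omega)]) hmass
    (fun k hk => by
      interval_cases k
      · norm_num
      · norm_num)
    (by rw [hmean]; norm_num) hL
  refine twinMove_witness_not ?_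
  convert h using 2
  · rw [hmean]; norm_num
  · rename_i k
    rcases k with _ | _ | _ | _ | _ | _ | _ | _ | _ | _ | _ | _ | _ | k
    all_goals norm_num

end LawDec

end Quant

end Summit.CriticalPhenomena.PercolationContinuityZ3.Theorems
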